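import Summits.AtomisticToContinuum.Crystallization.Theorems.FrustratedLawDichotomyTwoShellRigidityGaugedLadderC

/-!
# PART D of lens-5 g32 `TwoShellRigidityGaugedLadder.lean` (sha256 7a91fe068329bbfb…; module docstring of record in PART A)

§6 probe sets / covering constants / ls-gauge / non-vacuity, §7 assembly at the literal `θ = 1/100`, `η = 1/20` (`aperiodicFrustratedLawGap_of_gaugedLadders26`).
(Split A → B → C → D for the 400-line rule by prover hand 1, gen 11, --supports stmt-AtomisticToContinuum-27623; declarations byte-identical; gate-forced delta: docstrings on undocumented helper lemmas.)
-/

noncomputable section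

namespace Summit.AtomisticToContinuum.Crystallization.Theorems.FrustratedLawDichotomyTwoShellRigidityGaugedLadder


open Literature.Geometry.DiscreteGeometry
open Summit.AtomisticToContinuum.Crystallization.Theorems.FrustratedLawDichotomyTwoShellRigidityCut
open Summit.AtomisticToContinuum.Crystallization.Theorems.FrustratedLawDichotomyTwoShellRigidityCells
open Summit.AtomisticToContinuum.Crystallization.Theorems.FrustratedLawDichotomyBondGraphWindows
open Summit.AtomisticToContinuum.Crystallization.Theorems.FrustratedLawDichotomyTwoShellRigidityLadder (CapAprioriAt)
open Summit.AtomisticToContinuum.Crystallization.Theorems.FrustratedLawDichotomyTwoShellRigidityLadderCap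
  (capAprioriAt_fcc capAprioriAt_hcp capAprioriAt_trilateration_fcc capAprioriAt_trilateration_hcp)
open Summit.AtomisticToContinuum.Crystallization.Theorems.FrustratedLawDichotomyTwoShellRigidityProbeCovering (covers_probes26)
open scoped RealInnerProductSpace

/-! ## 6. Probe sets, covering constants, the least-squares gauge; non-vacuity of `RungLP` -/

/-- The six axis probes `±e₁, ±e₂, ±e₃`: directional bounds over them are sup-norm boxes. -/
def axisProbes : List E3 :=
  [EuclideanSpace.single 0 1, EuclideanSpace.single 1 1, EuclideanSpace.single 2 1,
    -EuclideanSpace.single 0 1, -EuclideanSpace.single 1 1, -EuclideanSpace.single 2 1]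

/-- Every axis probe has norm `≤ 1`. [folklore] -/
theorem norm_le_one_of_mem_axisProbes : ∀ n ∈ axisProbes, ‖n‖ ≤ 1 := by
  intro n hn
  simp only [axisProbes, List.mem_cons, List.not_mem_nil, or_false] at hn
  rcases hn with rfl | rfl | rfl | rfl | rfl | rfl <;> simp

/-- **Covering constant `√3` of the axis probes**: `‖v‖ ≤ √3 · max_k |v_k|`. [folklore] -/
theorem covers_axisProbes : Covers axisProbes (Real.sqrt 3) := by
  intro v
  obtain ⟨k, hk⟩ := Finite.exists_max (fun j : Fin 3 => |v j|)
  have hnorm : ‖v‖ ≤ Real.sqrt 3 * |v k| := by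
    have hsq : ‖v‖ ^ 2 ≤ 3 * (v k) ^ 2 := by
      rw [EuclideanSpace.real_norm_sq_eq, Fin.sum_univ_three]
      have e0 : (v 0) ^ 2 ≤ (v k) ^ 2 := sq_le_sq.2 (hk 0)
      have e1 : (v 1) ^ 2 ≤ (v k) ^ 2 := sq_le_sq.2 (hk 1)
      have e2 : (v 2) ^ 2 ≤ (v k) ^ 2 := sq_le_sq.2 (hk 2)
      linarith
    have h3 : Real.sqrt 3 * |v k| = Real.sqrt (3 * (v k) ^ 2) := by
      rw [Real.sqrt_mul (by norm_num : (0:ℝ) ≤ 3), Real.sqrt_sq_eq_abs]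
    rw [h3, ← Real.sqrt_sq (norm_nonneg v)]
    exact Real.sqrt_le_sqrt hsq
  by_cases hs : 0 ≤ v k
  · refine ⟨EuclideanSpace.single k 1, ?_, ?_⟩
    · fin_cases k <;> simp [axisProbes]
    · rw [EuclideanSpace.inner_single_left, map_one, one_mul, ← abs_of_nonneg hs]
      exact hnorm
  · refine ⟨-EuclideanSpace.single k 1, ?_, ?_⟩
    · fin_cases k <;> simp [axisProbes]
    · rw [inner_neg_left, EuclideanSpace.inner_single_left, map_one, one_mul]
      rw [abs_of_neg (not_le.1 hs)] at hnorm
      exact hnorm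

/-- Covering is monotone in the probe set: adding probes never increases the constant. [folklore] -/
theorem covers_of_subset {D D' : List E3} {ρ : ℝ} (hsub : ∀ n ∈ D, n ∈ D') (h : Covers D ρ) : Covers D' ρ := by
  intro v
  obtain ⟨n, hn, hle⟩ := h v
  exact ⟨n, hsub n hn, hle⟩

/-- A vector of `E3` from three coordinates. -/
def vec3 (a b c : ℝ) : E3 := WithLp.toLp 2 ![a, b, c]

/-- The twenty non-axis probes of types `(110)/√2` (twelve) and `(111)/√3` (eight). -/
def diagProbes : List E3 :=
  let s : ℝ := (Real.sqrt 2)⁻¹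
  let t : ℝ := (Real.sqrt 3)⁻¹
  [vec3 s s 0, vec3 s (-s) 0, vec3 (-s) s 0, vec3 (-s) (-s) 0,
    vec3 s 0 s, vec3 s 0 (-s), vec3 (-s) 0 s, vec3 (-s) 0 (-s),
    vec3 0 s s, vec3 0 s (-s), vec3 0 (-s) s, vec3 0 (-s) (-s),
    vec3 t t t, vec3 t t (-t), vec3 t (-t) t, vec3 t (-t) (-t),
    vec3 (-t) t t, vec3 (-t) t (-t), vec3 (-t) (-t) t, vec3 (-t) (-t) (-t)]

/-- **The 26 probes** `axisProbes ++ diagProbes` — the recommended ladder currency (first-order terminal cost `ρ₂₆ = 1.1281`, i.e. `11 %`,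
against `√3 = 73 %` for boxes; replay coefficients in `ℚ(√2, √3)`, or in `ℚ` after rescaling each probe row by its norm factor). -/
def probes26 : List E3 := axisProbes ++ diagProbes

/-- `‖vec3 a b c‖ = √(a² + b² + c²)`. [folklore] -/
theorem norm_vec3 (a b c : ℝ) : ‖vec3 a b c‖ = Real.sqrt (a ^ 2 + b ^ 2 + c ^ 2) := by
  rw [EuclideanSpace.norm_eq, Fin.sum_univ_three]
  simp [vec3, sq_abs]

/-- Coordinates of a probe inner product (for the replay files: every `DirFit` row / objective becomes a linear form in coordinates). -/
theorem inner_vec3 (a b c : ℝ) (v : E3) : ⟪vec3 a b c, v⟫ = a * v 0 + b * v 1 + c * v 2 := by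
  simp [vec3, PiLp.inner_apply, Fin.sum_univ_three, mul_comm]

/-- `⟪e_k, v⟫ = v k`. [folklore] -/
theorem inner_single_one_left (k : Fin 3) (v : E3) : ⟪EuclideanSpace.single k (1 : ℝ), v⟫ = v k := by
  simp [EuclideanSpace.inner_single_left]

/-- `⟪−e_k, v⟫ = −v k`. [folklore] -/
theorem inner_neg_single_one_left (k : Fin 3) (v : E3) : ⟪-EuclideanSpace.single k (1 : ℝ), v⟫ = -v k := by
  rw [inner_neg_left, inner_single_one_left]

/-- Every diagonal probe (types `(110)/√2`, `(111)/√3`) has norm `1`. [folklore] -/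
theorem norm_eq_one_of_mem_diagProbes : ∀ n ∈ diagProbes, ‖n‖ = 1 := by
  have h2 : ((Real.sqrt 2)⁻¹) ^ 2 = 1 / 2 := by rw [inv_pow, Real.sq_sqrt (by norm_num)]; norm_num
  have h3 : ((Real.sqrt 3)⁻¹) ^ 2 = 1 / 3 := by rw [inv_pow, Real.sq_sqrt (by norm_num)]; norm_num
  have eA : Real.sqrt ((Real.sqrt 2)⁻¹ ^ 2 + (Real.sqrt 2)⁻¹ ^ 2 + 0 ^ 2) = 1 := by rw [h2]; norm_num
  have eB : Real.sqrt ((Real.sqrt 2)⁻¹ ^ 2 + 0 ^ 2 + (Real.sqrt 2)⁻¹ ^ 2) = 1 := by rw [h2]; norm_num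
  have eC : Real.sqrt (0 ^ 2 + (Real.sqrt 2)⁻¹ ^ 2 + (Real.sqrt 2)⁻¹ ^ 2) = 1 := by rw [h2]; norm_num
  have eD : Real.sqrt ((Real.sqrt 3)⁻¹ ^ 2 + (Real.sqrt 3)⁻¹ ^ 2 + (Real.sqrt 3)⁻¹ ^ 2) = 1 := by rw [h3]; norm_num
  intro n hn
  simp only [diagProbes, List.mem_cons, List.not_mem_nil, or_false] at hn
  rcases hn with rfl | rfl | rfl | rfl | rfl | rfl | rfl | rfl | rfl | rfl | rfl | rfl | rfl | rfl | rfl | rfl | rfl | rfl | rfl | rfl <;>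
    simp only [norm_vec3, neg_sq, eA, eB, eC, eD]

/-- Every probe of `probes26` has norm `≤ 1`. [folklore] -/
theorem norm_le_one_of_mem_probes26 : ∀ n ∈ probes26, ‖n‖ ≤ 1 := by
  intro n hn
  rcases List.mem_append.1 hn with h | h
  · exact norm_le_one_of_mem_axisProbes n h
  · exact (norm_eq_one_of_mem_diagProbes n h).le


/-- The free covering constant of `probes26` (from the axis probes inside it). [folklore] -/
theorem covers_probes26_sqrt3 : Covers probes26 (Real.sqrt 3) :=
  covers_of_subset (fun _ hn => List.mem_append_left _ hn) covers_axisProbes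

/-- **The sharp covering constant of `probes26`** [PROVED below as `coversProbes26`, from hand-1's `covers_probes26` (p824086)]: the polar polytope `{v | ⟪n, v⟫ ≤ 1 ∀ n}` of the
26 probes has circumradius `ρ₂₆ = √(1 + (√2−1)² + (√3−√2)²) = √(9 − 2√2 − 2√6) = 1.128092…`, attained at the vertex `(1, √2−1, √3−√2)` and
its images (sort `|v₁| ≥ |v₂| ≥ |v₃|`; the active constraints are one probe of each type).  Stated with the rational upper bound `11281/10000`. -/
def CoversProbes26 : Prop := Covers probes26 (11281 / 10000)

/-- **The RATIONAL-PAIRING probe list `probes26Q`** = `{±√2·e_k} ∪ {(±1,±1,0)/√2 and permutations} ∪ {(±1,±1,±1)/√2}` (norms √2, 1, √(3/2)):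
its pairings with `√2·x` (fcc residual coordinates) and `√18·x` (hcp) are RATIONAL, so rung tables over it replay in `ℚ` (`linarith`), and its
covering constant is exactly `1` (`CoversProbes26Q`): slack radii and the terminal need no `ρ` at all. -/
def probes26Q : List E3 :=
  let r : ℝ := Real.sqrt 2
  let s : ℝ := (Real.sqrt 2)⁻¹
  [vec3 r 0 0, vec3 0 r 0, vec3 0 0 r, vec3 (-r) 0 0, vec3 0 (-r) 0, vec3 0 0 (-r),
    vec3 s s 0, vec3 s (-s) 0, vec3 (-s) s 0, vec3 (-s) (-s) 0,
    vec3 s 0 s, vec3 s 0 (-s), vec3 (-s) 0 s, vec3 (-s) 0 (-s),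
    vec3 0 s s, vec3 0 s (-s), vec3 0 (-s) s, vec3 0 (-s) (-s),
    vec3 s s s, vec3 s s (-s), vec3 s (-s) s, vec3 s (-s) (-s),
    vec3 (-s) s s, vec3 (-s) s (-s), vec3 (-s) (-s) s, vec3 (-s) (-s) (-s)]

/-- Every probe of the rescaled rational list `probes26Q` has norm `≤ √2`. [folklore] -/
theorem norm_le_sqrt_two_of_mem_probes26Q : ∀ n ∈ probes26Q, ‖n‖ ≤ Real.sqrt 2 := by
  have hr : (Real.sqrt 2) ^ 2 = 2 := Real.sq_sqrt (by norm_num)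
  have hs : ((Real.sqrt 2)⁻¹) ^ 2 = 1 / 2 := by rw [inv_pow, hr]; norm_num
  have key : ∀ q : ℝ, q ≤ 2 → Real.sqrt q ≤ Real.sqrt 2 := fun q hq => Real.sqrt_le_sqrt hq
  intro n hn
  simp only [probes26Q, List.mem_cons, List.not_mem_nil, or_false] at hn
  rcases hn with rfl | rfl | rfl | rfl | rfl | rfl | rfl | rfl | rfl | rfl | rfl | rfl | rfl | rfl | rfl | rfl | rfl | rfl | rfl | rfl |
    rfl | rfl | rfl | rfl | rfl | rfl <;>
    (rw [norm_vec3]; apply key; simp only [neg_sq, hr, hs]; norm_num)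

/-- **Covering constant `1` of `probes26Q`** [UNDECIDED · ATTACKABLE·S, Mathlib-only]: with `a ≥ b ≥ c` the sorted `|v_k|`,
`max(2a², (a+b+c)²/2) ≥ a² + b² + c²` (since `(a+b+c)² ≥ (2b+c)² ≥ 4b² + 4c²` for `b ≥ c ≥ 0`). -/
def CoversProbes26Q : Prop := Covers probes26Q 1

/-- **The least-squares gauge** `Σ_u u × x_u = 0` (componentwise): the first-order optimality condition of the orthogonal-Procrustes /
Kabsch fit; it kills the three infinitesimal rotations `x_u = ω × u` (`Σ_u u × (ω × u) = (Σ_u (‖u‖² I − u uᵀ)) ω = 8·ω` for both kissing patterns). -/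
def lsGauge (Pat : Finset E3) (x : ↥Pat → E3) : Prop :=
  (∑ u : ↥Pat, ((u : E3) 1 * x u 2 - (u : E3) 2 * x u 1) = 0) ∧
  (∑ u : ↥Pat, ((u : E3) 2 * x u 0 - (u : E3) 0 * x u 2) = 0) ∧
  (∑ u : ↥Pat, ((u : E3) 0 * x u 1 - (u : E3) 1 * x u 0) = 0)

/-- The zero residual field satisfies the least-squares gauge. [folklore] -/
theorem lsGauge_zero (Pat : Finset E3) : lsGauge Pat (fun _ => 0) := by
  simp [lsGauge]

/-- **`RungLP` is not vacuous**: the reference configuration (`x = 0`, `c = 0`, all scale ratios `1`) satisfies every hypothesis as soon as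
`θ ≥ 0`, the input tolerances are `≥ 0` and the gauge admits `0`; so a rung with a negative output tolerance is FALSE, and a certified rung says
something. [folklore] -/
theorem rungLP_nontrivial {Pat : Finset E3} {Din Dout : List E3} {Γ : (↥Pat → E3) → Prop} {θ ρ : ℝ} {P Q : ℝ × ℝ × ℝ × ℝ}
    (hθ : 0 ≤ θ) (hΓ : Γ (fun _ => 0)) (hP : 0 ≤ P.1 ∧ 0 ≤ P.2.1 ∧ 0 ≤ P.2.2.1 ∧ 0 ≤ P.2.2.2)
    (hlp : RungLP Pat Din Dout Γ θ ρ P Q) (hPat : Pat.Nonempty) (hD : Dout ≠ []) : 0 ≤ Q.1 := by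
  obtain ⟨z, hz⟩ := hPat
  obtain ⟨n, hn⟩ := List.exists_mem_of_ne_nil Dout hD
  have hbox : ∀ κ : ℝ, 1 ≤ κ → ScaleBox κ 1 := by
    intro κ hκ
    have hκ0 : 0 < κ := by linarith
    refine ⟨by linarith, hκ, ?_⟩
    have hid : κ⁻¹ + κ - 2 = (κ - 1) ^ 2 / κ := by field_simp; ring
    have h2 : 0 ≤ (κ - 1) ^ 2 / κ := div_nonneg (sq_nonneg _) hκ0.le
    linarith
  have hbs : ∀ e : E3, bondSq e 0 = 1 := by intro e; simp [bondSq]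
  have hrows : Rows θ 1 1 := ⟨by norm_num, by nlinarith⟩
  obtain ⟨hP1, hP2, hP3, hP4⟩ := hP
  have hfit0 : DirFit Din P (fun _ : ↥Pat => (0 : E3)) (fun _ _ => 0) := by
    refine ⟨?_, ?_, ?_, ?_⟩ <;> intros <;> simp only [sub_self, inner_zero_right] <;> assumption
  have h := hlp (fun _ => 0) (fun _ _ => 0) (fun _ => 1) (fun _ _ => 1) hfit0 hΓ
    (fun _ => hbox _ (by linarith)) (fun _ _ _ => hbox _ (by nlinarith))
    (fun u => by rw [hbs]; exact ⟨hrows, hrows⟩)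
    (fun u w _ => by rw [sub_self, hbs]; exact hrows)
    (fun u v _ w _ => by rw [sub_self, hbs]; exact ⟨hrows, hrows⟩)
    (fun _ => by rw [norm_zero, zero_pow two_ne_zero]; positivity)
    (fun _ _ _ => by rw [norm_zero, zero_pow two_ne_zero]; positivity)
    (fun _ _ _ => by rw [sub_self, norm_zero, zero_pow two_ne_zero]; positivity)
    (fun _ _ _ _ _ => by rw [sub_self, norm_zero, zero_pow two_ne_zero]; positivity)
  have := h.1 n hn ⟨z, hz⟩
  simpa only [inner_zero_right] using this


/-! ## 7. Assembly: one pattern, and the literal `θ = 1/100`, `η = 1/20` -/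

/-- **ONE PATTERN, WHOLE LADDER**: an ungauged `D`-entry `P₀` (census B&B in this currency, or the hand lane via
`gEntryAt_noGauge_of_coarse`) + ONE re-gauging `P₀ → P` + a chain of finite LPs `P → … → Q` + the covering constant `ρ` of `D` + `ρ·Q.1 < η`
⟹ `CappedRigidityAt θ η Pat`. [folklore] -/
theorem cappedRigidityAt_of_gaugedLadder {Pat : Finset E3} {D : List E3} {Γ : (↥Pat → E3) → Prop} {θ ρ η : ℝ}
    {P₀ P Q : ℝ × ℝ × ℝ × ℝ} {L : List (ℝ × ℝ × ℝ × ℝ)}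
    (h1 : ∀ z ∈ Pat, ‖z‖ = 1) (hθ : 0 ≤ θ) (hρ : 0 ≤ ρ) (hcov : Covers D ρ)
    (hU : GEntryAt Pat D (noGauge Pat) θ P₀) (hG : RegaugeAt Pat D Γ θ P₀ P)
    (hL : RungLPChain Pat D Γ θ ρ P L Q) (hη : ρ * Q.1 < η) : CappedRigidityAt θ η Pat :=
  cappedRigidityAt_of_gEntry hρ hcov
    (gEntryAt_of_gChain (gEntryAt_of_regauge hU hG) (gChainAt_of_rungLPChain h1 hθ hρ hcov L hL)) hη

/-- Same data, lens-4's `M⁺` currency `CappedRigidityBothAt θ (ρ·Q.1) (ρ·Q.2.1)`. [folklore] -/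
theorem cappedRigidityBothAt_of_gaugedLadder {Pat : Finset E3} {D : List E3} {Γ : (↥Pat → E3) → Prop} {θ ρ : ℝ}
    {P₀ P Q : ℝ × ℝ × ℝ × ℝ} {L : List (ℝ × ℝ × ℝ × ℝ)}
    (h1 : ∀ z ∈ Pat, ‖z‖ = 1) (hθ : 0 ≤ θ) (hρ : 0 ≤ ρ) (hcov : Covers D ρ)
    (hU : GEntryAt Pat D (noGauge Pat) θ P₀) (hG : RegaugeAt Pat D Γ θ P₀ P)
    (hL : RungLPChain Pat D Γ θ ρ P L Q) : CappedRigidityBothAt θ (ρ * Q.1) (ρ * Q.2.1) Pat :=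
  cappedRigidityBothAt_of_gEntry hρ hcov
    (gEntryAt_of_gChain (gEntryAt_of_regauge hU hG) (gChainAt_of_rungLPChain h1 hθ hρ hcov L hL))

/-- **`GLadderCertAt Pat ρ P L Q`** — THE CERTIFICATE STATEMENT at one pattern in the recommended currency (26 probes, least-squares gauge,
`θ = 1/100`, slack constant `ρ`): a chain of finite LINEAR statements `RungLP`.  [INSTRUMENTABLE · replay class = hand-2's
`FrustratedLawDichotomy{Hcp,}CapUniqueCert` (per output inequality one `linarith`/`linear_combination` with the LP multipliers);
NO transcendental function, NO rotation, NO per-rung isometry.] -/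
def GLadderCertAt (Pat : Finset E3) (ρ : ℝ) (P : ℝ × ℝ × ℝ × ℝ) (L : List (ℝ × ℝ × ℝ × ℝ)) (Q : ℝ × ℝ × ℝ × ℝ) : Prop :=
  RungLPChain Pat probes26 (lsGauge Pat) (1 / 100) ρ P L Q

/-- **`M = CappedRigidity (1/100) η` from, per pattern: an ungauged 26-probe entry, ONE ls-re-gauging, a `GLadderCertAt`, and `ρ·Q.1 < η`.**
[folklore chaining] -/
theorem cappedRigidity_of_gaugedLadders {ρ η : ℝ} {Pf₀ Pf Qf Ph₀ Ph Qh : ℝ × ℝ × ℝ × ℝ} {Lf Lh : List (ℝ × ℝ × ℝ × ℝ)}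
    (hρ : 0 ≤ ρ) (hcov : Covers probes26 ρ)
    (hUf : GEntryAt fccKissingPattern probes26 (noGauge _) (1 / 100) Pf₀)
    (hGf : RegaugeAt fccKissingPattern probes26 (lsGauge _) (1 / 100) Pf₀ Pf)
    (hCf : GLadderCertAt fccKissingPattern ρ Pf Lf Qf) (hQf : ρ * Qf.1 < η)
    (hUh : GEntryAt hcpKissingPattern probes26 (noGauge _) (1 / 100) Ph₀)
    (hGh : RegaugeAt hcpKissingPattern probes26 (lsGauge _) (1 / 100) Ph₀ Ph)
    (hCh : GLadderCertAt hcpKissingPattern ρ Ph Lh Qh) (hQh : ρ * Qh.1 < η) : CappedRigidity (1 / 100) η :=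
  ⟨cappedRigidityAt_of_gaugedLadder (fun _ hz => norm_eq_one_of_mem_fccKissingPattern hz) (by norm_num) hρ hcov hUf hGf hCf hQf,
    cappedRigidityAt_of_gaugedLadder (fun _ hz => norm_eq_one_of_mem_hcpKissingPattern hz) (by norm_num) hρ hcov hUh hGh hCh hQh⟩

/-- **`KR2Shape` (the door's `h2`) from `G ∧ P` and the two gauged ladders** (`ρ·Q.1 < 1/20` at both patterns). [folklore chaining] -/
theorem kr2Shape_of_gaugedLadders {ρ : ℝ} {Pf₀ Pf Qf Ph₀ Ph Qh : ℝ × ℝ × ℝ × ℝ} {Lf Lh : List (ℝ × ℝ × ℝ × ℝ)}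
    (hρ : 0 ≤ ρ) (hcov : Covers probes26 ρ) (hG : LinkClassification (1 / 100)) (hP : CapForcing (1 / 100))
    (hUf : GEntryAt fccKissingPattern probes26 (noGauge _) (1 / 100) Pf₀)
    (hGf : RegaugeAt fccKissingPattern probes26 (lsGauge _) (1 / 100) Pf₀ Pf)
    (hCf : GLadderCertAt fccKissingPattern ρ Pf Lf Qf) (hQf : ρ * Qf.1 < 1 / 20)
    (hUh : GEntryAt hcpKissingPattern probes26 (noGauge _) (1 / 100) Ph₀)
    (hGh : RegaugeAt hcpKissingPattern probes26 (lsGauge _) (1 / 100) Ph₀ Ph)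
    (hCh : GLadderCertAt hcpKissingPattern ρ Ph Lh Qh) (hQh : ρ * Qh.1 < 1 / 20) : KR2Shape :=
  kr2Shape_of_cut hG hP (cappedRigidity_of_gaugedLadders hρ hcov hUf hGf hCf hQf hUh hGh hCh hQh)

/-- **`AperiodicFrustratedLawGap` (crux of item 27623) BY NAME**, through the door, from `Price(1/100) ∧ G ∧ P` and the two gauged ladders.
[folklore chaining; `η` is taken half-way between `max ρ·Q.1` and `1/20`] -/
theorem aperiodicFrustratedLawGap_of_gaugedLadders {ρ : ℝ} {Pf₀ Pf Qf Ph₀ Ph Qh : ℝ × ℝ × ℝ × ℝ} {Lf Lh : List (ℝ × ℝ × ℝ × ℝ)}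
    (hρ : 0 ≤ ρ) (hcov : Covers probes26 ρ)
    (hDoor : Summit.AtomisticToContinuum.Crystallization.Theses.GrainCoreNetworkSplit.MuEquilibriumDoor) (hprice : PriceTol (1 / 100))
    (hG : LinkClassification (1 / 100)) (hP : CapForcing (1 / 100))
    (hUf : GEntryAt fccKissingPattern probes26 (noGauge _) (1 / 100) Pf₀)
    (hGf : RegaugeAt fccKissingPattern probes26 (lsGauge _) (1 / 100) Pf₀ Pf)
    (hCf : GLadderCertAt fccKissingPattern ρ Pf Lf Qf) (hQf : ρ * Qf.1 < 1 / 20)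
    (hUh : GEntryAt hcpKissingPattern probes26 (noGauge _) (1 / 100) Ph₀)
    (hGh : RegaugeAt hcpKissingPattern probes26 (lsGauge _) (1 / 100) Ph₀ Ph)
    (hCh : GLadderCertAt hcpKissingPattern ρ Ph Lh Qh) (hQh : ρ * Qh.1 < 1 / 20) :
    Summit.AtomisticToContinuum.Crystallization.Theses.FrustratedLawDichotomy.AperiodicFrustratedLawGap := by
  set η : ℝ := (max (ρ * Qf.1) (ρ * Qh.1) + 1 / 20) / 2 with hη_def
  have hmax : max (ρ * Qf.1) (ρ * Qh.1) < 1 / 20 := max_lt hQf hQh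
  have hη : η < 1 / 20 := by rw [hη_def]; linarith
  have hf : ρ * Qf.1 < η := by rw [hη_def]; linarith [le_max_left (ρ * Qf.1) (ρ * Qh.1)]
  have hh : ρ * Qh.1 < η := by rw [hη_def]; linarith [le_max_right (ρ * Qf.1) (ρ * Qh.1)]
  exact aperiodicFrustratedLawGap_of_price_of_cut (by norm_num) le_rfl hη hDoor hprice hG hP
    (cappedRigidity_of_gaugedLadders hρ hcov hUf hGf hCf hf hUh hGh hCh hh)

/-- **READING B (hand lane) in this currency**: `R(K) ∧ CapApriori(Kq)` at a pattern give the ungauged 26-probe entry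
`(K, Kq, 2K, Kq + K)·θ` (all 26 probes have norm `≤ 1`, proved). [folklore] -/
theorem gEntryAt_probes26_of_coarse {Pat : Finset E3} {K Kq θ : ℝ}
    (hR : CoarseCappedRigidityAt K θ Pat) (hQ : CapAprioriAt Kq K θ Pat) :
    GEntryAt Pat probes26 (noGauge Pat) θ (K * θ, Kq * θ, 2 * K * θ, (Kq + K) * θ) :=
  gEntryAt_noGauge_of_coarse norm_le_one_of_mem_probes26 hR hQ


/-- **Reading B entry with NO cap hypothesis**: `R_fcc(K)` at `θ ∈ (0, 1/100]` gives the ungauged 26-probe entry `(K, 54+2K, 2K, 54+3K)·θ`. -/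
theorem gEntryAt_fcc_of_coarse {K θ : ℝ} (hθ0 : 0 < θ) (hθ1 : θ ≤ 1 / 100) (hR : CoarseCappedRigidityAt K θ fccKissingPattern) :
    GEntryAt fccKissingPattern probes26 (noGauge _) θ (K * θ, (54 + 2 * K) * θ, 2 * K * θ, (54 + 2 * K + K) * θ) :=
  gEntryAt_probes26_of_coarse hR (capAprioriAt_fcc hθ0 hθ1)

/-- hcp: the hand lane's `R(K)` with the octahedral cap a-priori (`Kq = 54 + 2K`, p824270) is an ungauged 26-probe entry. [folklore] -/
theorem gEntryAt_hcp_of_coarse {K θ : ℝ} (hθ0 : 0 < θ) (hθ1 : θ ≤ 1 / 100) (hR : CoarseCappedRigidityAt K θ hcpKissingPattern) :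
    GEntryAt hcpKissingPattern probes26 (noGauge _) θ (K * θ, (54 + 2 * K) * θ, 2 * K * θ, (54 + 2 * K + K) * θ) :=
  gEntryAt_probes26_of_coarse hR (capAprioriAt_hcp hθ0 hθ1)

/-- **Reading B entry, trilateration caps** (hand-1 p823641/p824270): `R(K)` gives the ungauged 26-probe entry with `Kq = 2(K+2+θ) + (K+2+θ)²θ`
(`≈ 2K + 4`; at `θ = 1/100`: `Kq(10) = 25.5`, `Kq(16) = 39.3`). -/
theorem gEntryAt_fcc_of_coarse_tri {K θ : ℝ} (hθ0 : 0 < θ) (hθ1 : θ ≤ 1 / 100) (hK : 0 ≤ K) (hKθ : (K + 2 + θ) * θ ≤ 1 / 5)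
    (hR : CoarseCappedRigidityAt K θ fccKissingPattern) :
    GEntryAt fccKissingPattern probes26 (noGauge _) θ
      (K * θ, (2 * (K + 2 + θ) + (K + 2 + θ) ^ 2 * θ) * θ, 2 * K * θ, (2 * (K + 2 + θ) + (K + 2 + θ) ^ 2 * θ + K) * θ) :=
  gEntryAt_probes26_of_coarse hR (capAprioriAt_trilateration_fcc hθ0 hθ1 hK hKθ)

/-- hcp: the hand lane's `R(K)` with the TRILATERATION cap a-priori (`Kq = 2(K+2+θ) + (K+2+θ)²θ`, p824270) is an ungauged 26-probe entry. [folklore] -/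
theorem gEntryAt_hcp_of_coarse_tri {K θ : ℝ} (hθ0 : 0 < θ) (hθ1 : θ ≤ 1 / 100) (hK : 0 ≤ K) (hKθ : (K + 2 + θ) * θ ≤ 1 / 5)
    (hR : CoarseCappedRigidityAt K θ hcpKissingPattern) :
    GEntryAt hcpKissingPattern probes26 (noGauge _) θ
      (K * θ, (2 * (K + 2 + θ) + (K + 2 + θ) ^ 2 * θ) * θ, 2 * K * θ, (2 * (K + 2 + θ) + (K + 2 + θ) ^ 2 * θ + K) * θ) :=
  gEntryAt_probes26_of_coarse hR (capAprioriAt_trilateration_hcp hθ0 hθ1 hK hKθ)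

/-! ### The 26-probe covering constant BY NAME (hand-1 p824086) and the literal assembly with `ρ = 11281/10000` discharged -/

/-- **`CoversProbes26`** — the sharp covering constant `1.1281` of the 26 probes, PROVED by hand-1 (p824086, `covers_probes26`, exact degree-two
certificate on the sorted chamber); the probe lists agree definitionally. -/
theorem coversProbes26 : CoversProbes26 := fun v => covers_probes26 v

/-- `GLadderCert26At Pat P L Q`: the gauged LP-certificate chain of a pattern at the literal constants `θ = 1/100`, `ρ = 11281/10000`. -/
def GLadderCert26At (Pat : Finset E3) (P : ℝ × ℝ × ℝ × ℝ) (L : List (ℝ × ℝ × ℝ × ℝ)) (Q : ℝ × ℝ × ℝ × ℝ) : Prop :=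
  GLadderCertAt Pat (11281 / 10000) P L Q

/-- **`M = CappedRigidity (1/100) η` with the covering constant discharged**: per pattern an ungauged 26-probe entry, ONE ls-re-gauging,
a `GLadderCert26At` chain and the terminal arithmetic `1.1281·Q.1 < η`. [folklore chaining] -/
theorem cappedRigidity_of_gaugedLadders26 {η : ℝ} {Pf₀ Pf Qf Ph₀ Ph Qh : ℝ × ℝ × ℝ × ℝ} {Lf Lh : List (ℝ × ℝ × ℝ × ℝ)}
    (hUf : GEntryAt fccKissingPattern probes26 (noGauge _) (1 / 100) Pf₀)
    (hGf : RegaugeAt fccKissingPattern probes26 (lsGauge _) (1 / 100) Pf₀ Pf)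
    (hCf : GLadderCert26At fccKissingPattern Pf Lf Qf) (hQf : 11281 / 10000 * Qf.1 < η)
    (hUh : GEntryAt hcpKissingPattern probes26 (noGauge _) (1 / 100) Ph₀)
    (hGh : RegaugeAt hcpKissingPattern probes26 (lsGauge _) (1 / 100) Ph₀ Ph)
    (hCh : GLadderCert26At hcpKissingPattern Ph Lh Qh) (hQh : 11281 / 10000 * Qh.1 < η) : CappedRigidity (1 / 100) η :=
  cappedRigidity_of_gaugedLadders (by norm_num) coversProbes26 hUf hGf hCf hQf hUh hGh hCh hQh

/-- **`AperiodicFrustratedLawGap` (crux of item 27623) BY NAME with the covering constant discharged**: `Door ∧ Price ∧ G ∧ P`, per pattern an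
ungauged entry + ONE re-gauging + a `GLadderCert26At` chain, and `1.1281·Q.1 < 1/20` twice. -/
theorem aperiodicFrustratedLawGap_of_gaugedLadders26 {Pf₀ Pf Qf Ph₀ Ph Qh : ℝ × ℝ × ℝ × ℝ} {Lf Lh : List (ℝ × ℝ × ℝ × ℝ)}
    (hDoor : Summit.AtomisticToContinuum.Crystallization.Theses.GrainCoreNetworkSplit.MuEquilibriumDoor) (hprice : PriceTol (1 / 100))
    (hG : LinkClassification (1 / 100)) (hP : CapForcing (1 / 100))
    (hUf : GEntryAt fccKissingPattern probes26 (noGauge _) (1 / 100) Pf₀)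
    (hGf : RegaugeAt fccKissingPattern probes26 (lsGauge _) (1 / 100) Pf₀ Pf)
    (hCf : GLadderCert26At fccKissingPattern Pf Lf Qf) (hQf : 11281 / 10000 * Qf.1 < 1 / 20)
    (hUh : GEntryAt hcpKissingPattern probes26 (noGauge _) (1 / 100) Ph₀)
    (hGh : RegaugeAt hcpKissingPattern probes26 (lsGauge _) (1 / 100) Ph₀ Ph)
    (hCh : GLadderCert26At hcpKissingPattern Ph Lh Qh) (hQh : 11281 / 10000 * Qh.1 < 1 / 20) :
    Summit.AtomisticToContinuum.Crystallization.Theses.FrustratedLawDichotomy.AperiodicFrustratedLawGap :=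
  aperiodicFrustratedLawGap_of_gaugedLadders (by norm_num) coversProbes26 hDoor hprice hG hP hUf hGf hCf hQf hUh hGh hCh hQh

end Summit.AtomisticToContinuum.Crystallization.Theorems.FrustratedLawDichotomyTwoShellRigidityGaugedLadder
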